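import Mathlib
import Summits.Ventures.PercRepro2.RootPairSepCut

/-!
# Pendant pieces: marks beyond a cut vertex reduce to the cut vertex
(blind cell PercRepro2, mine-2 g21; proofs/MINE2-CUTU.md §10.5; structural lemmas and the pendant
factorisation `prob_pendant_mul` in `RootPairSepCut.lean`).

Let `c` be a cut vertex (`IsRootPairSep ends c c V₁ V₂`) with both roots in `V₁`, and write
`γ_v = {v ↔ c inside V₂}` for `v ∈ V₂`, `S(o, u, b)` for the cleared L-half of the weighted (PM).
A pendant `b` gives `S(o, u, b) = P(γ_b) · S(o, u, c)` (`halfL_pendant_b`), a pendant `o` gives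
`S(o, u, b) = P(γ_o) · S(c, u, b)` (`halfL_pendant_o`), and a pendant `u` gives
`S(o, u, b) = P(γ_u) · S(o, c, b) − (1 − P(γ_u)) · T₃` with
`T₃ = P(Q)·[P(Q)P(L_b H_o Q) − P(L_b Q)P(H_o Q)] ≤ 0` (`halfL_pendant_u`), hence
`S(o, u, b) ≥ P(γ_u) · S(o, c, b)` (`halfL_pendant_u_ge`).  So every mark hanging off a
non-separating cut vertex reduces to the cut vertex (with coincident marks allowed).
-/

namespace Summit.Ventures.PercRepro2

namespace RootPairSep

open SepPair

section Main

variable {V : Type*} {E : Type*} [Fintype E] [DecidableEq E] {R : Type*} [CommRing R]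

/-- **Pendant `b`.**  If `c` is a cut vertex with `a₁, a₂, o, u ∈ V₁` and `b ∈ V₂`, the cleared
L-half equals `P(γ_b)` times the cleared L-half with `b` replaced by `c`. -/
theorem halfL_pendant_b (p : E → R) {ends : E → Sym2 V} {c a₁ a₂ : V} {V₁ V₂ : Set V}
    (hs : IsRootPairSep ends c c V₁ V₂) [DecidablePred (· ∈ side₁ ends V₁)]
    [DecidablePred (· ∈ (side₁ ends V₁)ᶜ)] (ha₁ : a₁ ∈ V₁) (ha₂ : a₂ ∈ V₁) {o u b : V}
    (ho : o ∈ V₁) (hu : u ∈ V₁) (hb : b ∈ V₂) :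
    prob p (connEvent ends a₁ a₂)ᶜ *
          (prob p (connEvent ends a₁ a₂)ᶜ * prob p (connEvent ends a₁ b ∩ connEvent ends a₂ u ∩ (connEvent ends a₁ o ∪ connEvent ends a₂ o) ∩ (connEvent ends a₁ a₂)ᶜ) -
            prob p (connEvent ends a₁ b ∩ (connEvent ends a₁ a₂)ᶜ) * prob p (connEvent ends a₂ u ∩ (connEvent ends a₁ o ∪ connEvent ends a₂ o) ∩ (connEvent ends a₁ a₂)ᶜ)) -
        prob p ((connEvent ends a₁ o ∪ connEvent ends a₂ o) ∩ (connEvent ends a₁ a₂)ᶜ) *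
          (prob p (connEvent ends a₁ a₂)ᶜ * prob p (connEvent ends a₁ b ∩ connEvent ends a₂ u ∩ (connEvent ends a₁ a₂)ᶜ) -
            prob p (connEvent ends a₁ b ∩ (connEvent ends a₁ a₂)ᶜ) * prob p (connEvent ends a₂ u ∩ (connEvent ends a₁ a₂)ᶜ)) -
        prob p (connEvent ends a₁ a₂)ᶜ *
          (prob p (connEvent ends a₁ a₂)ᶜ * prob p (connEvent ends a₁ b ∩ connEvent ends a₂ o ∩ (connEvent ends a₁ a₂)ᶜ) -
            prob p (connEvent ends a₁ b ∩ (connEvent ends a₁ a₂)ᶜ) * prob p (connEvent ends a₂ o ∩ (connEvent ends a₁ a₂)ᶜ)) =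
      prob p (restrictTo (side₁ ends V₁)ᶜ ⁻¹' connEvent ends b c) *
        (prob p (connEvent ends a₁ a₂)ᶜ *
          (prob p (connEvent ends a₁ a₂)ᶜ * prob p (connEvent ends a₁ c ∩ connEvent ends a₂ u ∩ (connEvent ends a₁ o ∪ connEvent ends a₂ o) ∩ (connEvent ends a₁ a₂)ᶜ) -
            prob p (connEvent ends a₁ c ∩ (connEvent ends a₁ a₂)ᶜ) * prob p (connEvent ends a₂ u ∩ (connEvent ends a₁ o ∪ connEvent ends a₂ o) ∩ (connEvent ends a₁ a₂)ᶜ)) -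
        prob p ((connEvent ends a₁ o ∪ connEvent ends a₂ o) ∩ (connEvent ends a₁ a₂)ᶜ) *
          (prob p (connEvent ends a₁ a₂)ᶜ * prob p (connEvent ends a₁ c ∩ connEvent ends a₂ u ∩ (connEvent ends a₁ a₂)ᶜ) -
            prob p (connEvent ends a₁ c ∩ (connEvent ends a₁ a₂)ᶜ) * prob p (connEvent ends a₂ u ∩ (connEvent ends a₁ a₂)ᶜ)) -
        prob p (connEvent ends a₁ a₂)ᶜ *
          (prob p (connEvent ends a₁ a₂)ᶜ * prob p (connEvent ends a₁ c ∩ connEvent ends a₂ o ∩ (connEvent ends a₁ a₂)ᶜ) -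
            prob p (connEvent ends a₁ c ∩ (connEvent ends a₁ a₂)ᶜ) * prob p (connEvent ends a₂ o ∩ (connEvent ends a₁ a₂)ᶜ))) := by
  classical
  have hc₁ : c ∈ V₁ := hs.a₁_mem.1
  set D := (connEvent ends a₁ a₂)ᶜ with hDdef
  set Lb := connEvent ends a₁ b
  set Hu := connEvent ends a₂ u
  set Lo := connEvent ends a₁ o
  set Ho := connEvent ends a₂ o
  set Lc := connEvent ends a₁ c
  set Hc := connEvent ends a₂ c
  have det : ∀ {x y : V}, x ∈ V₁ → y ∈ V₁ → ∀ ω, ω ∈ connEvent ends x y ↔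
      restrictTo (side₁ ends V₁) ω ∈ connEvent ends x y :=
    fun hx hy ω => conn_detour hs (ω := ω) hx hy
  have dD : ∀ ω, ω ∈ (connEvent ends a₁ a₂)ᶜ ↔
      restrictTo (side₁ ends V₁) ω ∈ (connEvent ends a₁ a₂)ᶜ := fun ω => by
    have := det ha₁ ha₂ ω
    simp only [Set.mem_compl_iff]
    tauto
  have dand : ∀ {X Y : Set (Config E)}, (∀ ω, ω ∈ X ↔ restrictTo (side₁ ends V₁) ω ∈ X) →
      (∀ ω, ω ∈ Y ↔ restrictTo (side₁ ends V₁) ω ∈ Y) →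
      ∀ ω, ω ∈ X ∩ Y ↔ restrictTo (side₁ ends V₁) ω ∈ X ∩ Y := fun hX hY ω => by
    have := hX ω; have := hY ω
    simp only [Set.mem_inter_iff]
    tauto
  have dor : ∀ {X Y : Set (Config E)}, (∀ ω, ω ∈ X ↔ restrictTo (side₁ ends V₁) ω ∈ X) →
      (∀ ω, ω ∈ Y ↔ restrictTo (side₁ ends V₁) ω ∈ Y) →
      ∀ ω, ω ∈ X ∪ Y ↔ restrictTo (side₁ ends V₁) ω ∈ X ∪ Y := fun hX hY ω => by
    have := hX ω; have := hY ω
    simp only [Set.mem_union]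
    tauto
  have dHu := det ha₂ hu
  have doU := dor (det ha₁ ho) (det ha₂ ho)
  have dHo := det ha₂ ho
  have F1 := prob_pendant_mul p hs ha₁ hb (Y := connEvent ends a₂ u ∩ (connEvent ends a₁ o ∪ connEvent ends a₂ o) ∩ (connEvent ends a₁ a₂)ᶜ) (dand (dand dHu doU) dD)
  have F2 := prob_pendant_mul p hs ha₁ hb (Y := (connEvent ends a₁ a₂)ᶜ) dD
  have F3 := prob_pendant_mul p hs ha₁ hb (Y := connEvent ends a₂ u ∩ (connEvent ends a₁ a₂)ᶜ) (dand dHu dD)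
  have F4 := prob_pendant_mul p hs ha₁ hb (Y := connEvent ends a₂ o ∩ (connEvent ends a₁ a₂)ᶜ) (dand dHo dD)
  have a1 : Lb ∩ Hu ∩ (Lo ∪ Ho) ∩ D = Lb ∩ (Hu ∩ (Lo ∪ Ho) ∩ D) := by
    ext ω; simp only [Set.mem_inter_iff, Set.mem_union]; tauto
  have a3 : Lb ∩ Hu ∩ D = Lb ∩ (Hu ∩ D) := by
    ext ω; simp only [Set.mem_inter_iff]; tauto
  have a4 : Lb ∩ Ho ∩ D = Lb ∩ (Ho ∩ D) := by
    ext ω; simp only [Set.mem_inter_iff]; tauto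
  have c1 : Lc ∩ (Hu ∩ (Lo ∪ Ho) ∩ D) = Lc ∩ Hu ∩ (Lo ∪ Ho) ∩ D := by
    ext ω; simp only [Set.mem_inter_iff, Set.mem_union]; tauto
  have c3 : Lc ∩ (Hu ∩ D) = Lc ∩ Hu ∩ D := by
    ext ω; simp only [Set.mem_inter_iff]; tauto
  have c4 : Lc ∩ (Ho ∩ D) = Lc ∩ Ho ∩ D := by
    ext ω; simp only [Set.mem_inter_iff]; tauto
  rw [a1, a3, a4, F1, F2, F3, F4, c1, c3, c4]
  ring

/-- **Pendant `o`.**  If `c` is a cut vertex with `a₁, a₂, u, b ∈ V₁` and `o ∈ V₂`, the cleared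
L-half equals `P(γ_o)` times the cleared L-half with `o` replaced by `c`. -/
theorem halfL_pendant_o (p : E → R) {ends : E → Sym2 V} {c a₁ a₂ : V} {V₁ V₂ : Set V}
    (hs : IsRootPairSep ends c c V₁ V₂) [DecidablePred (· ∈ side₁ ends V₁)]
    [DecidablePred (· ∈ (side₁ ends V₁)ᶜ)] (ha₁ : a₁ ∈ V₁) (ha₂ : a₂ ∈ V₁) {o u b : V}
    (ho : o ∈ V₂) (hu : u ∈ V₁) (hb : b ∈ V₁) :
    prob p (connEvent ends a₁ a₂)ᶜ *
          (prob p (connEvent ends a₁ a₂)ᶜ * prob p (connEvent ends a₁ b ∩ connEvent ends a₂ u ∩ (connEvent ends a₁ o ∪ connEvent ends a₂ o) ∩ (connEvent ends a₁ a₂)ᶜ) -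
            prob p (connEvent ends a₁ b ∩ (connEvent ends a₁ a₂)ᶜ) * prob p (connEvent ends a₂ u ∩ (connEvent ends a₁ o ∪ connEvent ends a₂ o) ∩ (connEvent ends a₁ a₂)ᶜ)) -
        prob p ((connEvent ends a₁ o ∪ connEvent ends a₂ o) ∩ (connEvent ends a₁ a₂)ᶜ) *
          (prob p (connEvent ends a₁ a₂)ᶜ * prob p (connEvent ends a₁ b ∩ connEvent ends a₂ u ∩ (connEvent ends a₁ a₂)ᶜ) -
            prob p (connEvent ends a₁ b ∩ (connEvent ends a₁ a₂)ᶜ) * prob p (connEvent ends a₂ u ∩ (connEvent ends a₁ a₂)ᶜ)) -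
        prob p (connEvent ends a₁ a₂)ᶜ *
          (prob p (connEvent ends a₁ a₂)ᶜ * prob p (connEvent ends a₁ b ∩ connEvent ends a₂ o ∩ (connEvent ends a₁ a₂)ᶜ) -
            prob p (connEvent ends a₁ b ∩ (connEvent ends a₁ a₂)ᶜ) * prob p (connEvent ends a₂ o ∩ (connEvent ends a₁ a₂)ᶜ)) =
      prob p (restrictTo (side₁ ends V₁)ᶜ ⁻¹' connEvent ends o c) *
        (prob p (connEvent ends a₁ a₂)ᶜ *
          (prob p (connEvent ends a₁ a₂)ᶜ * prob p (connEvent ends a₁ b ∩ connEvent ends a₂ u ∩ (connEvent ends a₁ c ∪ connEvent ends a₂ c) ∩ (connEvent ends a₁ a₂)ᶜ) -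
            prob p (connEvent ends a₁ b ∩ (connEvent ends a₁ a₂)ᶜ) * prob p (connEvent ends a₂ u ∩ (connEvent ends a₁ c ∪ connEvent ends a₂ c) ∩ (connEvent ends a₁ a₂)ᶜ)) -
        prob p ((connEvent ends a₁ c ∪ connEvent ends a₂ c) ∩ (connEvent ends a₁ a₂)ᶜ) *
          (prob p (connEvent ends a₁ a₂)ᶜ * prob p (connEvent ends a₁ b ∩ connEvent ends a₂ u ∩ (connEvent ends a₁ a₂)ᶜ) -
            prob p (connEvent ends a₁ b ∩ (connEvent ends a₁ a₂)ᶜ) * prob p (connEvent ends a₂ u ∩ (connEvent ends a₁ a₂)ᶜ)) -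
        prob p (connEvent ends a₁ a₂)ᶜ *
          (prob p (connEvent ends a₁ a₂)ᶜ * prob p (connEvent ends a₁ b ∩ connEvent ends a₂ c ∩ (connEvent ends a₁ a₂)ᶜ) -
            prob p (connEvent ends a₁ b ∩ (connEvent ends a₁ a₂)ᶜ) * prob p (connEvent ends a₂ c ∩ (connEvent ends a₁ a₂)ᶜ))) := by
  classical
  have hc₁ : c ∈ V₁ := hs.a₁_mem.1
  set D := (connEvent ends a₁ a₂)ᶜ with hDdef
  set Lb := connEvent ends a₁ b
  set Hu := connEvent ends a₂ u
  set Lo := connEvent ends a₁ o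
  set Ho := connEvent ends a₂ o
  set Lc := connEvent ends a₁ c
  set Hc := connEvent ends a₂ c
  have det : ∀ {x y : V}, x ∈ V₁ → y ∈ V₁ → ∀ ω, ω ∈ connEvent ends x y ↔
      restrictTo (side₁ ends V₁) ω ∈ connEvent ends x y :=
    fun hx hy ω => conn_detour hs (ω := ω) hx hy
  have dD : ∀ ω, ω ∈ (connEvent ends a₁ a₂)ᶜ ↔
      restrictTo (side₁ ends V₁) ω ∈ (connEvent ends a₁ a₂)ᶜ := fun ω => by
    have := det ha₁ ha₂ ω
    simp only [Set.mem_compl_iff]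
    tauto
  have dand : ∀ {X Y : Set (Config E)}, (∀ ω, ω ∈ X ↔ restrictTo (side₁ ends V₁) ω ∈ X) →
      (∀ ω, ω ∈ Y ↔ restrictTo (side₁ ends V₁) ω ∈ Y) →
      ∀ ω, ω ∈ X ∩ Y ↔ restrictTo (side₁ ends V₁) ω ∈ X ∩ Y := fun hX hY ω => by
    have := hX ω; have := hY ω
    simp only [Set.mem_inter_iff]
    tauto
  have dor : ∀ {X Y : Set (Config E)}, (∀ ω, ω ∈ X ↔ restrictTo (side₁ ends V₁) ω ∈ X) →
      (∀ ω, ω ∈ Y ↔ restrictTo (side₁ ends V₁) ω ∈ Y) →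
      ∀ ω, ω ∈ X ∪ Y ↔ restrictTo (side₁ ends V₁) ω ∈ X ∪ Y := fun hX hY ω => by
    have := hX ω; have := hY ω
    simp only [Set.mem_union]
    tauto
  have dLb := det ha₁ hb
  have dHu := det ha₂ hu
  -- `oU ∩ Y = γ_o ∩ (cU ∩ Y)`: both root connections to `o` pass through `c`
  have hoU : ∀ Y : Set (Config E), (∀ ω, ω ∈ Y ↔ restrictTo (side₁ ends V₁) ω ∈ Y) →
      prob p ((connEvent ends a₁ o ∪ connEvent ends a₂ o) ∩ Y) =
        prob p (restrictTo (side₁ ends V₁)ᶜ ⁻¹' connEvent ends o c) * prob p ((connEvent ends a₁ c ∪ connEvent ends a₂ c) ∩ Y) := by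
    intro Y hY
    have ind : ∀ A B : Set (Config E),
        prob p (restrictTo (side₁ ends V₁)ᶜ ⁻¹' A ∩ restrictTo (side₁ ends V₁) ⁻¹' B) =
          prob p (restrictTo (side₁ ends V₁)ᶜ ⁻¹' A) * prob p (restrictTo (side₁ ends V₁) ⁻¹' B) :=
      fun A B => prob_inter_eq_mul_of_dependsOn p disjoint_compl_left
        (dependsOn_restrictTo _ A) (dependsOn_restrictTo _ B)
    have e : (connEvent ends a₁ o ∪ connEvent ends a₂ o) ∩ Y =
        restrictTo (side₁ ends V₁)ᶜ ⁻¹' connEvent ends o c ∩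
          restrictTo (side₁ ends V₁) ⁻¹' ((connEvent ends a₁ c ∪ connEvent ends a₂ c) ∩ Y) := by
      ext ω
      have h2 := conn_cut hs (ω := ω) ho ha₁
      have h2' := conn_cut hs (ω := ω) ho ha₂
      have h5 := hY ω
      simp only [Set.mem_inter_iff, Set.mem_union, Set.mem_preimage]
      change ((Conn ends ω a₁ o ∨ Conn ends ω a₂ o) ∧ ω ∈ Y) ↔
        Conn ends (restrictTo (side₁ ends V₁)ᶜ ω) o c ∧
          ((Conn ends (restrictTo (side₁ ends V₁) ω) a₁ c ∨
            Conn ends (restrictTo (side₁ ends V₁) ω) a₂ c) ∧ restrictTo (side₁ ends V₁) ω ∈ Y)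
      constructor
      · rintro ⟨h | h, hy⟩
        · obtain ⟨hc, hca⟩ := h2.1 (conn_symm h)
          exact ⟨hc, Or.inl (conn_symm hca), h5.1 hy⟩
        · obtain ⟨hc, hca⟩ := h2'.1 (conn_symm h)
          exact ⟨hc, Or.inr (conn_symm hca), h5.1 hy⟩
      · rintro ⟨hc, h | h, hy⟩
        · exact ⟨Or.inl (conn_symm (h2.2 ⟨hc, conn_symm h⟩)), h5.2 hy⟩
        · exact ⟨Or.inr (conn_symm (h2'.2 ⟨hc, conn_symm h⟩)), h5.2 hy⟩
    have e' : (connEvent ends a₁ c ∪ connEvent ends a₂ c) ∩ Y =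
        restrictTo (side₁ ends V₁) ⁻¹' ((connEvent ends a₁ c ∪ connEvent ends a₂ c) ∩ Y) := by
      ext ω
      have h4 := det ha₁ hc₁ ω
      have h4' := det ha₂ hc₁ ω
      have h5 := hY ω
      simp only [Set.mem_inter_iff, Set.mem_union, Set.mem_preimage]
      constructor
      · rintro ⟨h | h, hy⟩
        · exact ⟨Or.inl (h4.1 h), h5.1 hy⟩
        · exact ⟨Or.inr (h4'.1 h), h5.1 hy⟩
      · rintro ⟨h | h, hy⟩
        · exact ⟨Or.inl (h4.2 h), h5.2 hy⟩
        · exact ⟨Or.inr (h4'.2 h), h5.2 hy⟩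
    rw [e, ind, ← e']
  have G1 := hoU (connEvent ends a₁ b ∩ connEvent ends a₂ u ∩ (connEvent ends a₁ a₂)ᶜ) (dand (dand dLb dHu) dD)
  have G2 := hoU (connEvent ends a₂ u ∩ (connEvent ends a₁ a₂)ᶜ) (dand dHu dD)
  have G3 := hoU (connEvent ends a₁ a₂)ᶜ dD
  have G4 := prob_pendant_mul p (a₁ := a₂) hs ha₂ ho (Y := connEvent ends a₁ b ∩ (connEvent ends a₁ a₂)ᶜ) (dand dLb dD)
  have G5 := prob_pendant_mul p (a₁ := a₂) hs ha₂ ho (Y := (connEvent ends a₁ a₂)ᶜ) dD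
  have a1 : Lb ∩ Hu ∩ (Lo ∪ Ho) ∩ D = (Lo ∪ Ho) ∩ (Lb ∩ Hu ∩ D) := by
    ext ω; simp only [Set.mem_inter_iff, Set.mem_union]; tauto
  have a2 : Hu ∩ (Lo ∪ Ho) ∩ D = (Lo ∪ Ho) ∩ (Hu ∩ D) := by
    ext ω; simp only [Set.mem_inter_iff, Set.mem_union]; tauto
  have a3 : Lb ∩ Ho ∩ D = Ho ∩ (Lb ∩ D) := by
    ext ω; simp only [Set.mem_inter_iff]; tauto
  have c1 : (Lc ∪ Hc) ∩ (Lb ∩ Hu ∩ D) = Lb ∩ Hu ∩ (Lc ∪ Hc) ∩ D := by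
    ext ω; simp only [Set.mem_inter_iff, Set.mem_union]; tauto
  have c2 : (Lc ∪ Hc) ∩ (Hu ∩ D) = Hu ∩ (Lc ∪ Hc) ∩ D := by
    ext ω; simp only [Set.mem_inter_iff, Set.mem_union]; tauto
  have c3 : Hc ∩ (Lb ∩ D) = Lb ∩ Hc ∩ D := by
    ext ω; simp only [Set.mem_inter_iff]; tauto
  rw [a1, a2, a3, G1, G2, G3, G4, G5, c1, c2, c3]
  ring

/-- **Pendant `u`.**  If `c` is a cut vertex with `a₁, a₂, o, b ∈ V₁` and `u ∈ V₂`, the cleared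
L-half equals `P(γ_u) · S(o, c, b) − (1 − P(γ_u)) · T₃`, where
`T₃ = P(Q)·[P(Q)P(L_b H_o Q) − P(L_b Q)P(H_o Q)]` is the (BHK 1.4) third bracket. -/
theorem halfL_pendant_u (p : E → R) {ends : E → Sym2 V} {c a₁ a₂ : V} {V₁ V₂ : Set V}
    (hs : IsRootPairSep ends c c V₁ V₂) [DecidablePred (· ∈ side₁ ends V₁)]
    [DecidablePred (· ∈ (side₁ ends V₁)ᶜ)] (ha₁ : a₁ ∈ V₁) (ha₂ : a₂ ∈ V₁) {o u b : V}
    (ho : o ∈ V₁) (hu : u ∈ V₂) (hb : b ∈ V₁) :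
    prob p (connEvent ends a₁ a₂)ᶜ *
          (prob p (connEvent ends a₁ a₂)ᶜ * prob p (connEvent ends a₁ b ∩ connEvent ends a₂ u ∩ (connEvent ends a₁ o ∪ connEvent ends a₂ o) ∩ (connEvent ends a₁ a₂)ᶜ) -
            prob p (connEvent ends a₁ b ∩ (connEvent ends a₁ a₂)ᶜ) * prob p (connEvent ends a₂ u ∩ (connEvent ends a₁ o ∪ connEvent ends a₂ o) ∩ (connEvent ends a₁ a₂)ᶜ)) -
        prob p ((connEvent ends a₁ o ∪ connEvent ends a₂ o) ∩ (connEvent ends a₁ a₂)ᶜ) *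
          (prob p (connEvent ends a₁ a₂)ᶜ * prob p (connEvent ends a₁ b ∩ connEvent ends a₂ u ∩ (connEvent ends a₁ a₂)ᶜ) -
            prob p (connEvent ends a₁ b ∩ (connEvent ends a₁ a₂)ᶜ) * prob p (connEvent ends a₂ u ∩ (connEvent ends a₁ a₂)ᶜ)) -
        prob p (connEvent ends a₁ a₂)ᶜ *
          (prob p (connEvent ends a₁ a₂)ᶜ * prob p (connEvent ends a₁ b ∩ connEvent ends a₂ o ∩ (connEvent ends a₁ a₂)ᶜ) -
            prob p (connEvent ends a₁ b ∩ (connEvent ends a₁ a₂)ᶜ) * prob p (connEvent ends a₂ o ∩ (connEvent ends a₁ a₂)ᶜ)) =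
      prob p (restrictTo (side₁ ends V₁)ᶜ ⁻¹' connEvent ends u c) *
        (prob p (connEvent ends a₁ a₂)ᶜ *
          (prob p (connEvent ends a₁ a₂)ᶜ * prob p (connEvent ends a₁ b ∩ connEvent ends a₂ c ∩ (connEvent ends a₁ o ∪ connEvent ends a₂ o) ∩ (connEvent ends a₁ a₂)ᶜ) -
            prob p (connEvent ends a₁ b ∩ (connEvent ends a₁ a₂)ᶜ) * prob p (connEvent ends a₂ c ∩ (connEvent ends a₁ o ∪ connEvent ends a₂ o) ∩ (connEvent ends a₁ a₂)ᶜ)) -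
        prob p ((connEvent ends a₁ o ∪ connEvent ends a₂ o) ∩ (connEvent ends a₁ a₂)ᶜ) *
          (prob p (connEvent ends a₁ a₂)ᶜ * prob p (connEvent ends a₁ b ∩ connEvent ends a₂ c ∩ (connEvent ends a₁ a₂)ᶜ) -
            prob p (connEvent ends a₁ b ∩ (connEvent ends a₁ a₂)ᶜ) * prob p (connEvent ends a₂ c ∩ (connEvent ends a₁ a₂)ᶜ)) -
        prob p (connEvent ends a₁ a₂)ᶜ *
          (prob p (connEvent ends a₁ a₂)ᶜ * prob p (connEvent ends a₁ b ∩ connEvent ends a₂ o ∩ (connEvent ends a₁ a₂)ᶜ) -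
            prob p (connEvent ends a₁ b ∩ (connEvent ends a₁ a₂)ᶜ) * prob p (connEvent ends a₂ o ∩ (connEvent ends a₁ a₂)ᶜ))) -
      (1 - prob p (restrictTo (side₁ ends V₁)ᶜ ⁻¹' connEvent ends u c)) *
        (prob p (connEvent ends a₁ a₂)ᶜ * (prob p (connEvent ends a₁ a₂)ᶜ * prob p (connEvent ends a₁ b ∩ connEvent ends a₂ o ∩ (connEvent ends a₁ a₂)ᶜ) - prob p (connEvent ends a₁ b ∩ (connEvent ends a₁ a₂)ᶜ) * prob p (connEvent ends a₂ o ∩ (connEvent ends a₁ a₂)ᶜ))) := by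
  classical
  have hc₁ : c ∈ V₁ := hs.a₁_mem.1
  set D := (connEvent ends a₁ a₂)ᶜ with hDdef
  set Lb := connEvent ends a₁ b
  set Hu := connEvent ends a₂ u
  set Lo := connEvent ends a₁ o
  set Ho := connEvent ends a₂ o
  set Lc := connEvent ends a₁ c
  set Hc := connEvent ends a₂ c
  have det : ∀ {x y : V}, x ∈ V₁ → y ∈ V₁ → ∀ ω, ω ∈ connEvent ends x y ↔
      restrictTo (side₁ ends V₁) ω ∈ connEvent ends x y :=
    fun hx hy ω => conn_detour hs (ω := ω) hx hy
  have dD : ∀ ω, ω ∈ (connEvent ends a₁ a₂)ᶜ ↔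
      restrictTo (side₁ ends V₁) ω ∈ (connEvent ends a₁ a₂)ᶜ := fun ω => by
    have := det ha₁ ha₂ ω
    simp only [Set.mem_compl_iff]
    tauto
  have dand : ∀ {X Y : Set (Config E)}, (∀ ω, ω ∈ X ↔ restrictTo (side₁ ends V₁) ω ∈ X) →
      (∀ ω, ω ∈ Y ↔ restrictTo (side₁ ends V₁) ω ∈ Y) →
      ∀ ω, ω ∈ X ∩ Y ↔ restrictTo (side₁ ends V₁) ω ∈ X ∩ Y := fun hX hY ω => by
    have := hX ω; have := hY ω
    simp only [Set.mem_inter_iff]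
    tauto
  have dor : ∀ {X Y : Set (Config E)}, (∀ ω, ω ∈ X ↔ restrictTo (side₁ ends V₁) ω ∈ X) →
      (∀ ω, ω ∈ Y ↔ restrictTo (side₁ ends V₁) ω ∈ Y) →
      ∀ ω, ω ∈ X ∪ Y ↔ restrictTo (side₁ ends V₁) ω ∈ X ∪ Y := fun hX hY ω => by
    have := hX ω; have := hY ω
    simp only [Set.mem_union]
    tauto
  have dLb := det ha₁ hb
  have doU := dor (det ha₁ ho) (det ha₂ ho)
  have G1 := prob_pendant_mul p (a₁ := a₂) hs ha₂ hu (Y := connEvent ends a₁ b ∩ (connEvent ends a₁ o ∪ connEvent ends a₂ o) ∩ (connEvent ends a₁ a₂)ᶜ) (dand (dand dLb doU) dD)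
  have G2 := prob_pendant_mul p (a₁ := a₂) hs ha₂ hu (Y := (connEvent ends a₁ o ∪ connEvent ends a₂ o) ∩ (connEvent ends a₁ a₂)ᶜ) (dand doU dD)
  have G3 := prob_pendant_mul p (a₁ := a₂) hs ha₂ hu (Y := connEvent ends a₁ b ∩ (connEvent ends a₁ a₂)ᶜ) (dand dLb dD)
  have G4 := prob_pendant_mul p (a₁ := a₂) hs ha₂ hu (Y := (connEvent ends a₁ a₂)ᶜ) dD
  have a1 : Lb ∩ Hu ∩ (Lo ∪ Ho) ∩ D = Hu ∩ (Lb ∩ (Lo ∪ Ho) ∩ D) := by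
    ext ω; simp only [Set.mem_inter_iff, Set.mem_union]; tauto
  have a2 : Hu ∩ (Lo ∪ Ho) ∩ D = Hu ∩ ((Lo ∪ Ho) ∩ D) := by
    ext ω; simp only [Set.mem_inter_iff, Set.mem_union]; tauto
  have a3 : Lb ∩ Hu ∩ D = Hu ∩ (Lb ∩ D) := by
    ext ω; simp only [Set.mem_inter_iff]; tauto
  have c1 : Hc ∩ (Lb ∩ (Lo ∪ Ho) ∩ D) = Lb ∩ Hc ∩ (Lo ∪ Ho) ∩ D := by
    ext ω; simp only [Set.mem_inter_iff, Set.mem_union]; tauto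
  have c2 : Hc ∩ ((Lo ∪ Ho) ∩ D) = Hc ∩ (Lo ∪ Ho) ∩ D := by
    ext ω; simp only [Set.mem_inter_iff, Set.mem_union]; tauto
  have c3 : Hc ∩ (Lb ∩ D) = Lb ∩ Hc ∩ D := by
    ext ω; simp only [Set.mem_inter_iff]; tauto
  rw [a1, a2, a3, G1, G2, G3, G4, c1, c2, c3]
  ring

/-- **Pendant `u`, sign form.**  `S(o, u, b) ≥ P(γ_u) · S(o, c, b)` (BHK 1.4 for the third
bracket). -/
theorem halfL_pendant_u_ge [Fintype V] [DecidableEq V] [LinearOrder R] [IsStrictOrderedRing R]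
    (p : E → R) (hp : IsProbVec p) {ends : E → Sym2 V} {c a₁ a₂ : V} {V₁ V₂ : Set V}
    (hs : IsRootPairSep ends c c V₁ V₂) [DecidablePred (· ∈ side₁ ends V₁)]
    [DecidablePred (· ∈ (side₁ ends V₁)ᶜ)] (ha₁ : a₁ ∈ V₁) (ha₂ : a₂ ∈ V₁) {o u b : V}
    (ho : o ∈ V₁) (hu : u ∈ V₂) (hb : b ∈ V₁) :
    prob p (restrictTo (side₁ ends V₁)ᶜ ⁻¹' connEvent ends u c) *
        (prob p (connEvent ends a₁ a₂)ᶜ *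
          (prob p (connEvent ends a₁ a₂)ᶜ * prob p (connEvent ends a₁ b ∩ connEvent ends a₂ c ∩ (connEvent ends a₁ o ∪ connEvent ends a₂ o) ∩ (connEvent ends a₁ a₂)ᶜ) -
            prob p (connEvent ends a₁ b ∩ (connEvent ends a₁ a₂)ᶜ) * prob p (connEvent ends a₂ c ∩ (connEvent ends a₁ o ∪ connEvent ends a₂ o) ∩ (connEvent ends a₁ a₂)ᶜ)) -
        prob p ((connEvent ends a₁ o ∪ connEvent ends a₂ o) ∩ (connEvent ends a₁ a₂)ᶜ) *
          (prob p (connEvent ends a₁ a₂)ᶜ * prob p (connEvent ends a₁ b ∩ connEvent ends a₂ c ∩ (connEvent ends a₁ a₂)ᶜ) -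
            prob p (connEvent ends a₁ b ∩ (connEvent ends a₁ a₂)ᶜ) * prob p (connEvent ends a₂ c ∩ (connEvent ends a₁ a₂)ᶜ)) -
        prob p (connEvent ends a₁ a₂)ᶜ *
          (prob p (connEvent ends a₁ a₂)ᶜ * prob p (connEvent ends a₁ b ∩ connEvent ends a₂ o ∩ (connEvent ends a₁ a₂)ᶜ) -
            prob p (connEvent ends a₁ b ∩ (connEvent ends a₁ a₂)ᶜ) * prob p (connEvent ends a₂ o ∩ (connEvent ends a₁ a₂)ᶜ))) ≤
      prob p (connEvent ends a₁ a₂)ᶜ *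
          (prob p (connEvent ends a₁ a₂)ᶜ * prob p (connEvent ends a₁ b ∩ connEvent ends a₂ u ∩ (connEvent ends a₁ o ∪ connEvent ends a₂ o) ∩ (connEvent ends a₁ a₂)ᶜ) -
            prob p (connEvent ends a₁ b ∩ (connEvent ends a₁ a₂)ᶜ) * prob p (connEvent ends a₂ u ∩ (connEvent ends a₁ o ∪ connEvent ends a₂ o) ∩ (connEvent ends a₁ a₂)ᶜ)) -
        prob p ((connEvent ends a₁ o ∪ connEvent ends a₂ o) ∩ (connEvent ends a₁ a₂)ᶜ) *
          (prob p (connEvent ends a₁ a₂)ᶜ * prob p (connEvent ends a₁ b ∩ connEvent ends a₂ u ∩ (connEvent ends a₁ a₂)ᶜ) -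
            prob p (connEvent ends a₁ b ∩ (connEvent ends a₁ a₂)ᶜ) * prob p (connEvent ends a₂ u ∩ (connEvent ends a₁ a₂)ᶜ)) -
        prob p (connEvent ends a₁ a₂)ᶜ *
          (prob p (connEvent ends a₁ a₂)ᶜ * prob p (connEvent ends a₁ b ∩ connEvent ends a₂ o ∩ (connEvent ends a₁ a₂)ᶜ) -
            prob p (connEvent ends a₁ b ∩ (connEvent ends a₁ a₂)ᶜ) * prob p (connEvent ends a₂ o ∩ (connEvent ends a₁ a₂)ᶜ)) := by
  rw [halfL_pendant_u p hs ha₁ ha₂ ho hu hb]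
  have B2 := bhk_cross_cluster p hp ends a₁ a₂ (𝓤 := {W : Set V | b ∈ W})
    (𝓥 := {W : Set V | o ∈ W}) (fun _ _ h hW => h hW) (fun _ _ h hW => h hW)
  rw [RProduct.clusterInEvent_mem_eq, RProduct.clusterInEvent_mem_eq] at B2
  have hγ : prob p (restrictTo (side₁ ends V₁)ᶜ ⁻¹' connEvent ends u c) ≤ 1 := prob_le_one hp _
  have hQ : 0 ≤ prob p (connEvent ends a₁ a₂)ᶜ := prob_nonneg hp _
  have hT : prob p (connEvent ends a₁ a₂)ᶜ * (prob p (connEvent ends a₁ a₂)ᶜ * prob p (connEvent ends a₁ b ∩ connEvent ends a₂ o ∩ (connEvent ends a₁ a₂)ᶜ) - prob p (connEvent ends a₁ b ∩ (connEvent ends a₁ a₂)ᶜ) * prob p (connEvent ends a₂ o ∩ (connEvent ends a₁ a₂)ᶜ)) ≤ 0 := mul_nonpos_of_nonneg_of_nonpos hQ (by linarith [B2])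
  nlinarith [mul_nonneg (sub_nonneg.2 hγ) (neg_nonneg.2 hT)]

end Main

end RootPairSep

end Summit.Ventures.PercRepro2
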